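import Summits.BirchSwinnertonDyer.BirchSwinnertonDyer.Theses.ErratumRoadFive
import Summits.BirchSwinnertonDyer.BirchSwinnertonDyer.Theorems.ErratumRoadFiveIMCDivRoadFFSigmaDataBOfFacts
import Summits.BirchSwinnertonDyer.BirchSwinnertonDyer.Theorems.ErratumRoadFiveKernelFromPrintBOfFacts
import Summits.BirchSwinnertonDyer.BirchSwinnertonDyer.Theorems.ErratumRoadFiveIMCDivRoadFFFittingFrameBOfThm23
import Summits.BirchSwinnertonDyer.BirchSwinnertonDyer.Theorems.ErratumRoadFiveIMCDivRoadFFFittingFrameBOfMembers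
import HarnessLib

/-!
# Route `ErratumRoadFive` (rung K2, `p ≥ 5`): the binder `hWu : WuthrichShaDividesAnalyticSha` (support item 19285) of the deciding
# theorem `closes` (rev 42) is REDUNDANT — it is, by definition, conjunct 5 of the binder `h₅ : PublishedInputsFive` (support item 19066)
# (cell `bsd-stepL`, seat `bsd-stepL-imc-p1` g17; `--supports stmt-BirchSwinnertonDyer-19285 --as helper`)

This module imports the route file (its hypotheses and conclusions ARE route decls, by name), so no `_holds` link can be stated here.

## What this file proves

`Theses.ErratumRoadFive.WuthrichShaDividesAnalyticSha` is `Literature.…Wuthrich2014.sha_dvd_analyticSha` (Wuthrich 2014 Prop. 21: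
`#Ш[p^∞] ∣ #Ш_an` on the Kato side), and `Theses.ErratumRoadFive.PublishedInputsFive` is a fifteen-fold conjunction whose FIFTH conjunct is
the same constant. The route's deciding theorem `closes` (rev 42, after DROP-JSW) binds BOTH `(hWu : WuthrichShaDividesAnalyticSha)` and
`(h₅ : PublishedInputsFive)`, destructures `h₅` into `… hWu' …`, and feeds `hWu` to the 19061-body kernel
(`KernelFromPrintB.openInputIMCBody_of_print_of_coreB_of_rest3_of_notRam_of_facts`) and `hWu'` to the end-state assembly. Hence, BY NAME:

* §1 `wuthrichShaDividesAnalyticSha_of_publishedInputsFive` — **19285 ⟸ 19066** (a projection; definitional).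
* §2 `imcDivAtErratumDataAllR_of_memberPackage_of_sigmaLocal_of_items` — crux **20169 ⟸ 20529 + 20495 + 19283** (the `have h3` line of
  `closes` as a term; 20495 is CLOSED); `openInputIMC_of_memberPackage_of_rest3_of_notRam_of_publishedInputsFive` — the parent **19061 ⟸
  20529 + 20495 + 19625 + 19283 + 19066 + 19624 + 19282** (the Wuthrich input read from 19066, not 19285), and its F-split twin
  `openInputIMC_of_thm23_OPEN_of_frames_of_rest3_of_notRam_of_publishedInputsFive`.
* §3 `multiplicativeRankOne_of_items_without_wu` — the route's `closes` (rev 42) VERBATIM with the binder `hWu` DELETED (FOURTEEN items ⟹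
  the K2 leaf; `have h₁` reads `hWu'` from `h₅`), i.e. the kernel certificate that 19285 can leave the deciding theorem with no new
  hypothesis (a planner `--closes-file` = this body; turnkey `HOME/imc-p1/g17/DROPWU/`).
* §4 `multiplicativeRankOne_of_thm23_items_without_jsw_wu` — the same on plan g38's staged F-split glue (PROPOSAL (γ), `plan/SWAPF/`, with
  g16's DROP-JSW already applied): the edits COMMUTE.

HONEST FRAMING: theorems only (no definition, no named fact, no `sorry`); CONDITIONAL on the route's items as hypotheses (the member
package 20529 ∕ F4♯ is OPEN and unrefereed: erratum (2.4)–(2.5) via [FW21 Thm. 4.41]); Wuthrich's Prop. 21 itself is NOT proved here and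
stays a cited input (inside 19066); nothing is booked; BSD is proved for no pair; no census word, tier or label moves (T7).

References: [Wuthrich2014] Prop. 21 (p. 400); [Castella2018Erratum] (2.4)–(2.5), Thm. 1.1, Thm. 2.3 (pp. 1–4); [FouquetWan2021] Thm. 4.41
(claim); [JetchevSkinnerWan2017] Thm. 3.3.1 with §3.5 (3.5.c); [Castella2018Exceptional] Thms. 2.10–2.11; [MilneADT2006] I Thm. 4.10, Thm. 2.8.
-/

set_option autoImplicit false
-- the Theorems namespace of this sub repeats the summit name by design (D-0017 nested layout)
set_option linter.dupNamespace false

noncomputable section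

open scoped Classical
open WeierstrassCurve NumberField IsDedekindDomain
open Literature.NumberTheory.EllipticCurves Literature.NumberTheory.EllipticCurves.ModularForms
  Literature.NumberTheory.EllipticCurves.Rank1Residual Literature.NumberTheory.EllipticCurves.JetchevSkinnerWan2017
  Literature.NumberTheory.EllipticCurves.Castella2018 Literature.NumberTheory.GaloisCohomology
open Summit.BirchSwinnertonDyer.Rank1Residual.X11b
open Summit.BirchSwinnertonDyer.BirchSwinnertonDyer.Theses.ErratumRoadFive

namespace Summit.BirchSwinnertonDyer.BirchSwinnertonDyer.Theorems

/-! ### §1 Support 19285 is a conjunct of support 19066 -/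

/-- **Support 19285 `WuthrichShaDividesAnalyticSha` BY NAME from support 19066 `PublishedInputsFive`**: the fifth conjunct (both unfold to
`Wuthrich2014.sha_dvd_analyticSha`). A projection; CONDITIONAL on 19066; nothing booked. [cite: Wuthrich2014, Prop. 21 (p. 400)] -/
theorem wuthrichShaDividesAnalyticSha_of_publishedInputsFive (h₅ : PublishedInputsFive) : WuthrichShaDividesAnalyticSha :=
  h₅.2.2.2.2.1

/-! ### §2 Crux 20169 and the parent 19061 with 19066 in place of 19285 -/

/-- **Crux 20169 `IMCDivAtErratumDataAllR` BY NAME from `20529 + 20495 + 19283`** (the `have h3` line of `closes` rev 42 as a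
stand-alone term: Road FF Σ-data from the local Σ-atom 20495 — CLOSED, `jswSigmaLocalCharIdeal_holds` — with Shapiro
`prop323_XAc_equiv_XBigDecomp_holds` in-kernel and GZK ∕ modularity ∕ the two Poitou–Tate facts = conjuncts 2, 4, 13, 14 of 19283;
Fitting frame from the OPEN member package 20529). CONDITIONAL (20529 OPEN, unrefereed); nothing booked.
[claim: Castella2018Erratum, status: under-review] [claim: FouquetWan2021, status: under-review]
[cite: Castella2018Erratum, (2.4)–(2.5) and proof of Thm. 1.1 (pp. 3–4)] [cite: JetchevSkinnerWan2017, proof of Thm. 6.1.6 (local display)] -/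
theorem imcDivAtErratumDataAllR_of_memberPackage_of_sigmaLocal_of_items (hMem : CastellaErratumMemberPackage)
    (hloc : JSWSigmaLocalCharIdeal) (hF : PublishedInputsIMCReduction) : IMCDivAtErratumDataAllR := fun W _ _ p _ ↦
  Summit.BirchSwinnertonDyer.Rank1Residual.X11b.P2.imcDivIntCoreFrameAtErratumDataB_of_roadFF_fitting
    (Summit.BirchSwinnertonDyer.Rank1Residual.X11b.P2.RoadFF.sigmaDataAtErratumDataB_of_sigmaLocal_of_prop323_of_facts
      W p hloc Literature.NumberTheory.EllipticCurves.SkinnerUrban2014.prop323_XAc_equiv_XBigDecomp_holds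
      hF.2.1 hF.2.2.2.1 hF.2.2.2.2.2.2.2.2.2.2.2.2.1 hF.2.2.2.2.2.2.2.2.2.2.2.2.2.1)
    (Summit.BirchSwinnertonDyer.Rank1Residual.X11b.P2.RoadFF.fittingCongruenceFrameAtErratumDataB_of_members_of_prop323
      hMem Literature.NumberTheory.EllipticCurves.SkinnerUrban2014.prop323_XAc_equiv_XBigDecomp_holds W p)

/-- **The parent 19061 `OpenInputIMC` BY NAME from SEVEN ITEMS, 19066 in place of 19285:
`19061 ⟸ 20529 + 20495 + 19625 + 19283 + 19066 + 19624 + 19282`** (20495 CLOSED) — §2's crux certificate composed with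
`KernelFromPrintB.openInputIMCBody_of_print_of_coreB_of_rest3_of_notRam_of_facts`, the Wuthrich input read from `PublishedInputsFive`.
CONDITIONAL; nothing booked; BSD is proved for no pair. [claim: Castella2018Erratum, status: under-review] [claim: FouquetWan2021, status: under-review]
[cite: Castella2018Erratum, Thm. 1.1 and proof (pp. 1–4)] [cite: Castella2018Exceptional, Thms. 2.10–2.11] [cite: Wuthrich2014, Prop. 21 (p. 400)] -/
theorem openInputIMC_of_memberPackage_of_rest3_of_notRam_of_publishedInputsFive (hMem : CastellaErratumMemberPackage)
    (hloc : JSWSigmaLocalCharIdeal) (hVN : BDPValueContinuityInput) (hF : PublishedInputsIMCReduction) (h₅ : PublishedInputsFive)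
    (hrest : RamNoErratumDataAtFive) (hOff : OpenInputNotRam) : OpenInputIMC := by
  intro W _ _ p _
  exact KernelFromPrintB.openInputIMCBody_of_print_of_coreB_of_rest3_of_notRam_of_facts hVN
    (imcDivAtErratumDataAllR_of_memberPackage_of_sigmaLocal_of_items hMem hloc hF) hF
    (wuthrichShaDividesAnalyticSha_of_publishedInputsFive h₅) hrest hOff W p

/-- **The parent 19061 BY NAME from F4♯ + F3♯ + SIX ITEMS** (20495, 19625, 19283, 19066, 19624, 19282): the F-split twin of the
previous certificate (Fitting frame by `P2.RoadFF.fittingCongruenceFrameAtErratumDataB_of_thm23_OPEN_of_frames`, imc-p1 g15). CONDITIONAL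
(F4♯ OPEN); nothing booked; BSD is proved for no pair. [claim: Castella2018Erratum, status: under-review] [claim: FouquetWan2021, status: under-review]
[cite: Castella2018Erratum, Thm. 1.1, Thm. 2.3 and proof (pp. 1–4)] [cite: Wuthrich2014, Prop. 21 (p. 400)] -/
theorem openInputIMC_of_thm23_OPEN_of_frames_of_rest3_of_notRam_of_publishedInputsFive
    (h23 : erratumThm23_charIdeal_sigma_le_of_isTorsion_OPEN) (hL : erratum_exists_frames_members_sigma_congruence)
    (hloc : JSWSigmaLocalCharIdeal) (hVN : BDPValueContinuityInput) (hF : PublishedInputsIMCReduction) (h₅ : PublishedInputsFive)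
    (hrest : RamNoErratumDataAtFive) (hOff : OpenInputNotRam) : OpenInputIMC := by
  intro W _ _ p _
  refine KernelFromPrintB.openInputIMCBody_of_print_of_coreB_of_rest3_of_notRam_of_facts hVN (fun W _ _ p _ ↦ ?_) hF
    (wuthrichShaDividesAnalyticSha_of_publishedInputsFive h₅) hrest hOff W p
  exact Summit.BirchSwinnertonDyer.Rank1Residual.X11b.P2.imcDivIntCoreFrameAtErratumDataB_of_roadFF_fitting
    (Summit.BirchSwinnertonDyer.Rank1Residual.X11b.P2.RoadFF.sigmaDataAtErratumDataB_of_sigmaLocal_of_prop323_of_facts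
      W p hloc Literature.NumberTheory.EllipticCurves.SkinnerUrban2014.prop323_XAc_equiv_XBigDecomp_holds
      hF.2.1 hF.2.2.2.1 hF.2.2.2.2.2.2.2.2.2.2.2.2.1 hF.2.2.2.2.2.2.2.2.2.2.2.2.2.1)
    (Summit.BirchSwinnertonDyer.Rank1Residual.X11b.P2.RoadFF.fittingCongruenceFrameAtErratumDataB_of_thm23_OPEN_of_frames h23 hL W p)

/-! ### §3 The K2 leaf from the route's items without 19285 (`closes` rev 42 minus the binder `hWu`) -/

/-- **THE K2 LEAF FROM THE ROUTE'S ITEMS WITHOUT 19285** — `Theses.ErratumRoadFive.closes` (rev 42) VERBATIM with the binder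
`hWu : WuthrichShaDividesAnalyticSha` DELETED: the `have h₁` line is moved below the destructuring of `h₅` and reads its Wuthrich input
`hWu'` from there; every other line byte-identical. This is the kernel certificate that support item 19285 can leave the deciding theorem
with NO new hypothesis (a planner `--closes-file` = this body). CONDITIONAL on the remaining fourteen items (one OPEN crux among them);
nothing booked; BSD is proved for no pair; no tier, census word or label moves (T7).
[claim: Castella2018Erratum, status: under-review] [claim: FouquetWan2021, status: under-review]
[cite: Wuthrich2014, Prop. 21 (p. 400)] [cite: JetchevSkinnerWan2017, Thm. 3.3.1 with §3.5 (3.5.c)] [cite: MilneADT2006, Ch. I, Thm. 4.10 and Thm. 2.8] -/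
theorem multiplicativeRankOne_of_items_without_wu (hMem : CastellaErratumMemberPackage) (hloc : JSWSigmaLocalCharIdeal)
    (hrest : RamNoErratumDataAtFive) (hOff : OpenInputNotRam)
    (hF : PublishedInputsIMCReduction) (hVN : BDPValueContinuityInput)
    (hRes : EulerHalfNotRamNoInertSetAtFive) (h₃ : X11aLowerHalf) (h₄ : NonSurjCorner)
    (h₅ : PublishedInputsFive) (hJL : ShimuraParametrizationDataNonempty) (hCO : PastenComponentOrdersInput)
    (hCTi : ShimuraCasselsTateLevelInputs) (hESi : ShimuraHeegnerEulerSystemInertPrintedR) :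
    Summit.BirchSwinnertonDyer.Rank1Residual.X11b.MultiplicativeRankOne := by
  show Summit.BirchSwinnertonDyer.Rank1Residual.X11b.MultiplicativeRankOne
  have h3 : IMCDivAtErratumDataAllR := fun W _ _ p _ ↦
    Summit.BirchSwinnertonDyer.Rank1Residual.X11b.P2.imcDivIntCoreFrameAtErratumDataB_of_roadFF_fitting
      (Summit.BirchSwinnertonDyer.Rank1Residual.X11b.P2.RoadFF.sigmaDataAtErratumDataB_of_sigmaLocal_of_prop323_of_facts
        W p hloc Literature.NumberTheory.EllipticCurves.SkinnerUrban2014.prop323_XAc_equiv_XBigDecomp_holds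
        hF.2.1 hF.2.2.2.1 hF.2.2.2.2.2.2.2.2.2.2.2.2.1 hF.2.2.2.2.2.2.2.2.2.2.2.2.2.1)
      (Summit.BirchSwinnertonDyer.Rank1Residual.X11b.P2.RoadFF.fittingCongruenceFrameAtErratumDataB_of_members_of_prop323
        hMem Literature.NumberTheory.EllipticCurves.SkinnerUrban2014.prop323_XAc_equiv_XBigDecomp_holds W p)
  obtain ⟨hGZ, hKo, hB, hSk, hWu', hGZK, hmod, hnf, hHL, hFHs, hMaz, hBDMTV, hFH, hPT, hEP⟩ := h₅
  have hESg : Literature.NumberTheory.EllipticCurves.shimuraCurve_heegnerSystem_primitivesGuarded :=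
    Summit.BirchSwinnertonDyer.BirchSwinnertonDyer.Theorems.primitivesGuarded_of_GZK_of_entire_of_primitivesFromFive
      hGZK hmod hESi
  have hKOi : ShimuraKolyvaginOrderBoundInertFromFive := by
    refine Summit.BirchSwinnertonDyer.BirchSwinnertonDyer.Theorems.shimuraKolyvaginOrderBoundInert_of_shimuraLabelsGuarded_of_casselsTate_of_poitouTate
      hPT ?_ hESg
    intro K _ _ W _ p M₀ hp hp2 hM₀ _ c hc hcc e hμ hadd₁ hadd₂ hgal halt hnd
    obtain ⟨inv, hPT', hH3, hperf, hB', hPτ⟩ := hCTi K W p M₀ hp hp2 hM₀ c hc hcc e hμ hadd₁ hadd₂ hgal halt hnd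
    exact ⟨inv, hPT', hH3, fun v ↦ (hperf v).1.injective, hB', hPτ⟩
  have hHKi : Literature.NumberTheory.EllipticCurves.shimuraCurve_heegnerPoint_grossZagier_kolyvagin_inert := by
    intro W _ _ p _ N _ K _ _ S Dt X W' _ P₀ hN hp5 hsurj hK hS hin hsp hpS hc hmin
    obtain ⟨-, y, degy, -, -, h0y, hvy, hLy, -⟩ := hESg W p N K S Dt X W' P₀ hN hp5 hsurj hK hS hin hsp hpS hc hmin
    exact ⟨y, degy, h0y, hvy, hLy,
      hKOi W p N K S Dt X W' P₀ hN hp5 hsurj hK hS hin hsp hpS hc hmin y degy h0y hvy hLy⟩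
  have h₁ : ∀ (W : WeierstrassCurve ℚ) [W.IsElliptic] [W.IsGloballyMinimal] (p : ℕ) [Fact p.Prime],
      Summit.BirchSwinnertonDyer.Rank1Residual.X11b.P2OpenInputOnTreeAt W p :=
    Summit.BirchSwinnertonDyer.BirchSwinnertonDyer.Theorems.KernelFromPrintB.openInputIMCBody_of_print_of_coreB_of_rest3_of_notRam_of_facts
      hVN h3 hF hWu' hrest hOff
  exact Summit.BirchSwinnertonDyer.BirchSwinnertonDyer.Theorems.multiplicativeRankOne_of_endState_inert_notRamResidual
    hGZ hKo hB hSk hWu' hGZK hmod hnf hHL hFHs hMaz hBDMTV hFH hPT hEP hJL hCO hHKi h₁ hRes h₃ h₄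

/-! ### §4 The same on the planner's staged F-split with DROP-JSW applied (plan/SWAPF ∘ DROPJSW): minus `h331`, minus `hWu` -/

/-- **THE K2 LEAF FROM THE F-SPLIT ITEMS WITHOUT 19626 AND WITHOUT 19285** — g16's `multiplicativeRankOne_of_thm23_items_without_jsw`
(plan g38's staged `closes` of PROPOSAL (γ) with `(hMem : CastellaErratumMemberPackage)` ↦ F4♯ `erratumThm23_charIdeal_sigma_le_of_isTorsion_OPEN`
∕ F3♯ `erratum_exists_frames_members_sigma_congruence`, binder `h331` deleted) with the binder `hWu` ALSO deleted as in §3. Certifies that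
the three glue edits (E-free open input; drop 19626; drop 19285) COMMUTE. CONDITIONAL (F4♯ OPEN, claim-tagged); nothing booked; BSD is proved
for no pair; no tier, census word or label moves (T7). [claim: Castella2018Erratum, status: under-review] [claim: FouquetWan2021, status: under-review]
[cite: Castella2018Erratum, Thm. 2.3 and (2.4)–(2.5) (pp. 3–4)] [cite: Wuthrich2014, Prop. 21 (p. 400)] -/
theorem multiplicativeRankOne_of_thm23_items_without_jsw_wu
    (h23 : erratumThm23_charIdeal_sigma_le_of_isTorsion_OPEN) (hMF : erratum_exists_frames_members_sigma_congruence)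
    (hloc : JSWSigmaLocalCharIdeal)
    (hrest : RamNoErratumDataAtFive) (hOff : OpenInputNotRam)
    (hF : PublishedInputsIMCReduction) (hVN : BDPValueContinuityInput)
    (hRes : EulerHalfNotRamNoInertSetAtFive) (h₃ : X11aLowerHalf) (h₄ : NonSurjCorner)
    (h₅ : PublishedInputsFive) (hJL : ShimuraParametrizationDataNonempty) (hCO : PastenComponentOrdersInput)
    (hCTi : ShimuraCasselsTateLevelInputs) (hESi : ShimuraHeegnerEulerSystemInertPrintedR) :
    Summit.BirchSwinnertonDyer.Rank1Residual.X11b.MultiplicativeRankOne := by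
  show Summit.BirchSwinnertonDyer.Rank1Residual.X11b.MultiplicativeRankOne
  have h3 : IMCDivAtErratumDataAllR := fun W _ _ p _ ↦
    Summit.BirchSwinnertonDyer.Rank1Residual.X11b.P2.imcDivIntCoreFrameAtErratumDataB_of_roadFF_fitting
      (Summit.BirchSwinnertonDyer.Rank1Residual.X11b.P2.RoadFF.sigmaDataAtErratumDataB_of_sigmaLocal_of_prop323_of_facts
        W p hloc Literature.NumberTheory.EllipticCurves.SkinnerUrban2014.prop323_XAc_equiv_XBigDecomp_holds
        hF.2.1 hF.2.2.2.1 hF.2.2.2.2.2.2.2.2.2.2.2.2.1 hF.2.2.2.2.2.2.2.2.2.2.2.2.2.1)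
      (Summit.BirchSwinnertonDyer.Rank1Residual.X11b.P2.RoadFF.fittingCongruenceFrameAtErratumDataB_of_thm23_OPEN_of_frames
        h23 hMF W p)
  obtain ⟨hGZ, hKo, hB, hSk, hWu', hGZK, hmod, hnf, hHL, hFHs, hMaz, hBDMTV, hFH, hPT, hEP⟩ := h₅
  have hESg : Literature.NumberTheory.EllipticCurves.shimuraCurve_heegnerSystem_primitivesGuarded :=
    Summit.BirchSwinnertonDyer.BirchSwinnertonDyer.Theorems.primitivesGuarded_of_GZK_of_entire_of_primitivesFromFive
      hGZK hmod hESi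
  have hKOi : ShimuraKolyvaginOrderBoundInertFromFive := by
    refine Summit.BirchSwinnertonDyer.BirchSwinnertonDyer.Theorems.shimuraKolyvaginOrderBoundInert_of_shimuraLabelsGuarded_of_casselsTate_of_poitouTate
      hPT ?_ hESg
    intro K _ _ W _ p M₀ hp hp2 hM₀ _ c hc hcc e hμ hadd₁ hadd₂ hgal halt hnd
    obtain ⟨inv, hPT', hH3, hperf, hB', hPτ⟩ := hCTi K W p M₀ hp hp2 hM₀ c hc hcc e hμ hadd₁ hadd₂ hgal halt hnd
    exact ⟨inv, hPT', hH3, fun v ↦ (hperf v).1.injective, hB', hPτ⟩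
  have hHKi : Literature.NumberTheory.EllipticCurves.shimuraCurve_heegnerPoint_grossZagier_kolyvagin_inert := by
    intro W _ _ p _ N _ K _ _ S Dt X W' _ P₀ hN hp5 hsurj hK hS hin hsp hpS hc hmin
    obtain ⟨-, y, degy, -, -, h0y, hvy, hLy, -⟩ := hESg W p N K S Dt X W' P₀ hN hp5 hsurj hK hS hin hsp hpS hc hmin
    exact ⟨y, degy, h0y, hvy, hLy,
      hKOi W p N K S Dt X W' P₀ hN hp5 hsurj hK hS hin hsp hpS hc hmin y degy h0y hvy hLy⟩
  have h₁ : ∀ (W : WeierstrassCurve ℚ) [W.IsElliptic] [W.IsGloballyMinimal] (p : ℕ) [Fact p.Prime],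
      Summit.BirchSwinnertonDyer.Rank1Residual.X11b.P2OpenInputOnTreeAt W p :=
    Summit.BirchSwinnertonDyer.BirchSwinnertonDyer.Theorems.KernelFromPrintB.openInputIMCBody_of_print_of_coreB_of_rest3_of_notRam_of_facts
      hVN h3 hF hWu' hrest hOff
  exact Summit.BirchSwinnertonDyer.BirchSwinnertonDyer.Theorems.multiplicativeRankOne_of_endState_inert_notRamResidual
    hGZ hKo hB hSk hWu' hGZK hmod hnf hHL hFHs hMaz hBDMTV hFH hPT hEP hJL hCO hHKi h₁ hRes h₃ h₄

end Summit.BirchSwinnertonDyer.BirchSwinnertonDyer.Theorems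

end
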